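import Literature.Algebra.Homology.DiscreteRepExtInternalHomGalois
import Literature.Algebra.Homology.PermutationDualCoinduced
import Literature.Algebra.Homology.BrauerGroupInflationRestriction
import Literature.NumberTheory.GaloisRepresentations.GaloisCohomologyLayerInflationTransitive
import Literature.NumberTheory.GaloisRepresentations.GaloisCohomologyUnitsLayerInflation
import HarnessLib

/-!
# `H¹(K, Hom(ℤ[β], A)) = 0` for a permutation module with uniform open isotropy (native cochains):
# `H¹(K, Hom(ℤ[G]ᵐ, K̄ˣ)) = 0` when `Γ_K` acts on `G` through a homomorphism

Topic `NumberTheory/GaloisRepresentations`; namespace `Literature.NumberTheory.GaloisRepresentations.HomPermutation`.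
Definitions with bodies (the hypotheses `UniformIsotropy`, `PermutedBasis`, the descended layer structures
`quotSMul`, `layerPermRep`, the comparison `homLayerIso`, `unitsLayerRepIso`) and theorems; no named fact, no
instance, no `sorry`.  Sequel to `GaloisCohomologyLayerInflationTransitive` (door-c6: `layerInf`,
`infOneLayer_layerInf`, `exists_infOneLayer_eq`).  Any field `K : Type`; cohomology is the tree's NATIVE
`galoisCohomology` and Mathlib's `groupCohomology` at the finite layers.

THE MATHEMATICS.  Let `P` be a discrete `Γ_K`-module with a `ℤ`-basis `(e_b)_{b ∈ β}` PERMUTED by `Γ_K`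
(`σ e_b = e_{σ b}`) such that every isotropy group of the `Γ_K`-set `β` is the open normal subgroup
`Γ_L = Gal(K̄/L)` of a finite Galois `L ⊆ K̄` (the case in hand: `P = ℤ[Gal(E₀/k)]ᵐ` restricted to a
decomposition group, or to `Γ_K` itself).  For a discrete module `A` and every finite Galois `E ⊇ L`:
`Hom(P, A)^{Γ_E} = Hom(P, A^{Γ_E})` (`Γ_E ⊆ Γ_L` acts trivially on `P`) is, as a module over
`Γ_K/Γ_E`, the dual `Hom(ℤ[β], A^{Γ_E})` of a permutation module with uniform isotropy `Γ_L/Γ_E`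
(`homLayerIso`), so by Brown III (5.8) + Shapiro (`PermutationDual.isZero_groupCohomology_ihom`, door-c6 g16)
**`H¹(Γ_K/Γ_E, Hom(P, A)^{Γ_E}) = 0` as soon as `H¹(Γ_L/Γ_E, A^{Γ_E}) = 0`** (`isZero_layer_hom`).
Since `H¹(K, X) = ⋃_E inf H¹(Γ_K/Γ_E, X^{Γ_E})` (tree `exists_infOneLayer_eq`) and the layers may be
enlarged (`infOneLayer_layerInf`), **`H¹(K, Hom(P, A)) = 0`** (`galoisCohomology_hom_eq_zero`).  For
`A = K̄ˣ` the layer hypothesis is Hilbert 90 for `E/L'` (`unitsLayerEquiv` + `InflationRestriction.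
isZero_H1_res_units`): **`galoisCohomology_hom_units_eq_zero`**.

USE (presentation road to Milne ADT I Lemma 4.13, crux `stmt-BirchSwinnertonDyer-19295`, door-c6 g16): with
`HomDualPresentation.dualδ₀_surjective`, every class of `H¹(K_v, Hom(M^D, K̄_vˣ)) = H¹(K_v, M)` is the
readout `δ₀ h` of an equivariant homomorphism `h : M₁ → K̄_vˣ` out of the relation module of door-c4's
free presentation (restricted to the decomposition group: all isotropy groups of `Γ_{K_v}` on
`Fin m × Gal(E₀/K)` are `Gal(K̄_v/K_v E₀)`).
HONEST FRAMING: no case of Poitou–Tate or BSD is proved here.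

## References
* J. S. Milne, *Arithmetic Duality Theorems* (2nd ed. 2006), I §0 (0.8), I Lemma 4.13 (proof). [MilneADT2006]
* K. S. Brown, *Cohomology of Groups*, GTM 87 (1982), III §5 Prop. (5.8), III §6 Prop. (6.2).
  [Brown1982CohomologyGroups]
* J.-P. Serre, *Galois Cohomology* (1997), I §2.2 Prop. 8 and Cor. 1 (`H¹ = lim→` over the layers).
  [SerreGaloisCohomology1997]
* J.-P. Serre, *Local Fields*, GTM 67 (1979), X §1 Prop. 2 (Hilbert 90). [SerreLocalFields1979]
-/

noncomputable section

namespace Literature.NumberTheory.GaloisRepresentations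

namespace HomPermutation

open CategoryTheory CategoryTheory.Limits groupCohomology Field
open Literature.Algebra.Homology Literature.Algebra.Homology.DiscreteRep DiscreteGaloisModule

variable (K : Type) [Field K]

/-! ## §1 A permutation module at a layer `E ⊇ L`: descended action and `Hom(P, A)^{Γ_E} ≅ Hom(P_E, A^{Γ_E})` -/

section Layer

variable {β : Type} [MulAction (absoluteGaloisGroup K) β]
  {VP : Type} [AddCommGroup VP] [TopologicalSpace VP] [DiscreteTopology VP] [Module.Finite ℤ VP]
  {W : Type} [AddCommGroup W] [TopologicalSpace W] [DiscreteTopology W]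

/-- The hypothesis "every isotropy group of the `Γ_K`-set `β` is `Γ_L`". [cite: Brown1982CohomologyGroups, III §5 Prop. (5.8)] -/
def UniformIsotropy (β : Type) [MulAction (absoluteGaloisGroup K) β]
    (L : IntermediateField K (AlgebraicClosure K)) [Normal K L] : Prop :=
  ∀ b : β, MulAction.stabilizer (absoluteGaloisGroup K) b = absGaloisFixingSubgroup L

/-- The hypothesis "the basis `e` of `P` is permuted by `Γ_K` through its action on `β`".
[cite: Brown1982CohomologyGroups, III §5] -/
def PermutedBasis (ρP : DiscreteGaloisModule K VP) (e : Module.Basis β ℤ VP) : Prop :=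
  ∀ (γ : absoluteGaloisGroup K) (i : β), ρP γ (e i) = e (γ • i)

variable {K}
variable {L : IntermediateField K (AlgebraicClosure K)} [Normal K L] (hstab : UniformIsotropy K β L)
  {ρP : DiscreteGaloisModule K VP} {e : Module.Basis β ℤ VP} (he : PermutedBasis K ρP e)
  (ρA : DiscreteGaloisModule K W)
  {E : IntermediateField K (AlgebraicClosure K)} [Normal K E] (hLE : L ≤ E)

include hstab hLE in
/-- `Γ_E` (for `E ⊇ L`) fixes every point of `β`. [cite: Brown1982CohomologyGroups, III §5] -/
theorem smul_eq_self {γ : absoluteGaloisGroup K} (hγ : γ ∈ absGaloisFixingSubgroup E) (b : β) : γ • b = b := by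
  have h : γ ∈ MulAction.stabilizer (absoluteGaloisGroup K) b := by
    rw [hstab b]
    exact absGaloisFixingSubgroup_antitone K L E hLE hγ
  exact MulAction.mem_stabilizer_iff.mp h

include hstab he hLE in
omit [Module.Finite ℤ VP] in
/-- `Γ_E` acts trivially on `P`. [cite: Brown1982CohomologyGroups, III §5] -/
theorem apply_eq_self {γ : absoluteGaloisGroup K} (hγ : γ ∈ absGaloisFixingSubgroup E) (x : VP) : ρP γ x = x := by
  have h : (ρP γ : VP →ₗ[ℤ] VP) = LinearMap.id :=
    e.ext fun i => by rw [he, smul_eq_self hstab hLE hγ, LinearMap.id_apply]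
  exact LinearMap.congr_fun h x

/-- **The descended action of `Γ_K/Γ_E` on `β`** (to be installed locally with `letI`).
[cite: Brown1982CohomologyGroups, III §5] -/
@[reducible]
def quotSMul (hstab : UniformIsotropy K β L) (hLE : L ≤ E) :
    MulAction (absoluteGaloisGroup K ⧸ absGaloisFixingSubgroup E) β :=
  MulAction.compHom β (QuotientGroup.lift (absGaloisFixingSubgroup E)
    (MulAction.toPermHom (absoluteGaloisGroup K) β) fun γ hγ => by
      rw [MonoidHom.mem_ker]
      exact Equiv.ext fun b => smul_eq_self hstab hLE hγ b)

/-- `[γ] • b = γ • b`. [cite: Brown1982CohomologyGroups, III §5] -/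
theorem quotSMul_mk_smul (γ : absoluteGaloisGroup K) (b : β) :
    (letI := quotSMul hstab hLE; (γ : absoluteGaloisGroup K ⧸ absGaloisFixingSubgroup E) • b) = γ • b := rfl

/-- **The descended representation `P_E` of `Γ_K/Γ_E` on `P`.** [cite: Brown1982CohomologyGroups, III §5] -/
def layerPermRep (hstab : UniformIsotropy K β L) (he : PermutedBasis K ρP e) (hLE : L ≤ E) :
    Representation ℤ (absoluteGaloisGroup K ⧸ absGaloisFixingSubgroup E) VP :=
  QuotientGroup.lift (absGaloisFixingSubgroup E) ρP.toRepresentation fun γ hγ => by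
    rw [MonoidHom.mem_ker]
    exact LinearMap.ext fun x => apply_eq_self hstab he hLE hγ x

omit [Module.Finite ℤ VP] in
/-- `P_E [γ] = ρP γ`. [cite: Brown1982CohomologyGroups, III §5] -/
@[simp] theorem layerPermRep_mk (γ : absoluteGaloisGroup K) :
    layerPermRep hstab he hLE (γ : absoluteGaloisGroup K ⧸ absGaloisFixingSubgroup E) = ρP γ := rfl

/-- `P_E` as an object of `Rep ℤ (Γ_K/Γ_E)`. [cite: Brown1982CohomologyGroups, III §5] -/
abbrev layerPerm (hstab : UniformIsotropy K β L) (he : PermutedBasis K ρP e) (hLE : L ≤ E) :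
    Rep ℤ (absoluteGaloisGroup K ⧸ absGaloisFixingSubgroup E) :=
  Rep.of (layerPermRep hstab he hLE)

omit [Module.Finite ℤ VP] in
/-- The basis is permuted by `Γ_K/Γ_E`. [cite: Brown1982CohomologyGroups, III §5 Prop. (5.8)] -/
theorem layerPerm_basis (q : absoluteGaloisGroup K ⧸ absGaloisFixingSubgroup E) (i : β) :
    (layerPerm hstab he hLE).ρ q (e i) = e (letI := quotSMul hstab hLE; q • i) := by
  induction q using QuotientGroup.induction_on with
  | H γ => exact he γ i

/-- Every isotropy group of `Γ_K/Γ_E` on `β` is `Γ_L/Γ_E`. [cite: Brown1982CohomologyGroups, III §5 Prop. (5.8)] -/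
theorem stabilizer_quot (b : β) :
    (letI := quotSMul hstab hLE; MulAction.stabilizer (absoluteGaloisGroup K ⧸ absGaloisFixingSubgroup E) b) =
      (absGaloisFixingSubgroup L).map (QuotientGroup.mk' (absGaloisFixingSubgroup E)) := by
  letI := quotSMul hstab hLE
  ext q
  induction q using QuotientGroup.induction_on with
  | H γ =>
    rw [MulAction.mem_stabilizer_iff, quotSMul_mk_smul, Subgroup.mem_map]
    constructor
    · intro hγ
      refine ⟨γ, ?_, rfl⟩
      rw [← hstab b]
      exact MulAction.mem_stabilizer_iff.mpr hγ
    · rintro ⟨γ', hγ', hq⟩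
      have hq' : (γ' : absoluteGaloisGroup K ⧸ absGaloisFixingSubgroup E) = γ := hq
      rw [QuotientGroup.eq] at hq'
      have h1 : γ = γ' * (γ'⁻¹ * γ) := by group
      rw [h1, mul_smul, smul_eq_self hstab hLE hq' b]
      rw [← hstab b] at hγ'
      exact MulAction.mem_stabilizer_iff.mp hγ'

/-- The vectors of the layer `Hom(P, A)^{Γ_E}` take values in `A^{Γ_E}`.
[cite: MilneADT2006, I §0 (0.8)] -/
theorem apply_mem_invariants (hstab : UniformIsotropy K β L) (he : PermutedBasis K ρP e) (hLE : L ≤ E)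
    (w : (absGaloisLayerRep K E (homGaloisModule ρP ρA)).V) (x : VP) :
    (show VP →ₗ[ℤ] W from (w.1 : DiscreteRep.HomCarrier VP W)) x ∈
      Representation.invariants (ρA.toRepresentation.comp (absGaloisFixingSubgroup E).subtype) := by
  intro τ
  have hw := w.2 τ
  have hw' : homGaloisModule ρP ρA (τ : absoluteGaloisGroup K) (w.1 : DiscreteRep.HomCarrier VP W) = w.1 := hw
  rw [homGaloisModule_apply] at hw'
  have hx := LinearMap.congr_fun hw' (ρP (τ : absoluteGaloisGroup K) x)
  simp only [LinearMap.coe_comp, Function.comp_apply] at hx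
  rw [← Module.End.mul_apply, ← map_mul, inv_mul_cancel, map_one, Module.End.one_apply,
    apply_eq_self hstab he hLE τ.2 x] at hx
  exact hx

/-- `Hom(P, A)^{Γ_E} → Hom(P, A^{Γ_E})` on vectors. [cite: MilneADT2006, I §0 (0.8)] -/
def toHomInvariants (hstab : UniformIsotropy K β L) (he : PermutedBasis K ρP e) (hLE : L ≤ E)
    (w : (absGaloisLayerRep K E (homGaloisModule ρP ρA)).V) : VP →ₗ[ℤ] (absGaloisLayerRep K E ρA).V :=
  LinearMap.codRestrict _ (show VP →ₗ[ℤ] W from (w.1 : DiscreteRep.HomCarrier VP W))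
    (apply_mem_invariants ρA hstab he hLE w)

/-- `Hom(P, A^{Γ_E}) → Hom(P, A)^{Γ_E}` on vectors. [cite: MilneADT2006, I §0 (0.8)] -/
def ofHomInvariants (hstab : UniformIsotropy K β L) (he : PermutedBasis K ρP e) (hLE : L ≤ E)
    (G : VP →ₗ[ℤ] (absGaloisLayerRep K E ρA).V) : (absGaloisLayerRep K E (homGaloisModule ρP ρA)).V :=
  ⟨((Representation.invariants (ρA.toRepresentation.comp (absGaloisFixingSubgroup E).subtype)).subtype ∘ₗ G :
      VP →ₗ[ℤ] W), fun τ => by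
    change homGaloisModule ρP ρA (τ : absoluteGaloisGroup K) _ = _
    rw [homGaloisModule_apply]
    refine LinearMap.ext fun x => ?_
    simp only [LinearMap.coe_comp, Function.comp_apply, Submodule.coe_subtype]
    rw [apply_eq_self hstab he hLE ((absGaloisFixingSubgroup E).inv_mem τ.2) x]
    exact (G x).2 τ⟩

/-- **`Hom(P, A)^{Γ_E} ≅ Hom(P_E, A^{Γ_E})` as representations of `Γ_K/Γ_E`** (the latter Mathlib's
internal hom `(Rep.ihom P_E).obj (A^{Γ_E})`). [cite: MilneADT2006, I §0 (0.8)][cite: Brown1982CohomologyGroups, III §5] -/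
def homLayerIso (hstab : UniformIsotropy K β L) (he : PermutedBasis K ρP e) (hLE : L ≤ E) :
    absGaloisLayerRep K E (homGaloisModule ρP ρA) ≅
      (Rep.ihom (layerPerm hstab he hLE)).obj (absGaloisLayerRep K E ρA) :=
  Rep.mkIso (Representation.Equiv.mk
    { toFun := toHomInvariants ρA hstab he hLE
      invFun := ofHomInvariants ρA hstab he hLE
      map_add' := fun _ _ => rfl
      map_smul' := fun _ _ => rfl
      left_inv := fun _ => rfl
      right_inv := fun _ => rfl } fun q => by
    induction q using QuotientGroup.induction_on with
    | H σ =>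
      refine LinearMap.ext fun w => LinearMap.ext fun x => Subtype.ext ?_
      change (show VP →ₗ[ℤ] W from
          (homGaloisModule ρP ρA σ (w.1 : DiscreteRep.HomCarrier VP W) : DiscreteRep.HomCarrier VP W)) x =
        ρA σ ((show VP →ₗ[ℤ] W from (w.1 : DiscreteRep.HomCarrier VP W)) (ρP σ⁻¹ x))
      rw [homGaloisModule_apply]
      rfl)

/-- **`Hⁿ(Γ_K/Γ_E, Hom(P, A)^{Γ_E}) = 0` whenever `Hⁿ(Γ_L/Γ_E, A^{Γ_E}) = 0`** (Brown III (5.8) + Shapiro for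
the permutation module `P_E` with uniform isotropy `Γ_L/Γ_E`).
[cite: Brown1982CohomologyGroups, III §5 Prop. (5.8), III §6 Prop. (6.2)][cite: MilneADT2006, I Lemma 4.13 (proof)] -/
theorem isZero_layer_hom (hstab : UniformIsotropy K β L) (he : PermutedBasis K ρP e) (hLE : L ≤ E) (n : ℕ)
    (hX : IsZero (groupCohomology (Rep.res ((absGaloisFixingSubgroup L).map
      (QuotientGroup.mk' (absGaloisFixingSubgroup E))).subtype (absGaloisLayerRep K E ρA)) n)) :
    IsZero (groupCohomology (absGaloisLayerRep K E (homGaloisModule ρP ρA)) n) := by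
  letI := quotSMul hstab hLE
  exact (PermutationDual.isZero_groupCohomology_ihom (absGaloisLayerRep K E ρA) _
    (stabilizer_quot hstab hLE) (A := layerPerm hstab he hLE) e
    (layerPerm_basis hstab he hLE) n hX).of_iso
    ((groupCohomology.functor ℤ _ n).mapIso (homLayerIso ρA hstab he hLE))

end Layer

/-! ## §2 `H¹(K, Hom(P, A)) = 0` -/

section Vanishing

variable {K}
variable {β : Type} [MulAction (absoluteGaloisGroup K) β]
  {L : IntermediateField K (AlgebraicClosure K)} [FiniteDimensional K L] [Normal K L]
  {VP : Type} [AddCommGroup VP] [TopologicalSpace VP] [DiscreteTopology VP] [Module.Finite ℤ VP]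
  {ρP : DiscreteGaloisModule K VP} {e : Module.Basis β ℤ VP}
  {W : Type} [AddCommGroup W] [TopologicalSpace W] [DiscreteTopology W]

/-- **`H¹(K, Hom(P, A)) = 0`** for a permutation module `P` whose basis has uniform isotropy `Γ_L`, as soon as
`H¹(Γ_L/Γ_E, A^{Γ_E}) = 0` for every finite Galois `E ⊇ L` (every class lives on some layer, which may be
taken to contain `L`). [cite: SerreGaloisCohomology1997, I §2.2 Proposition 8 and Corollary 1][cite: Brown1982CohomologyGroups, III §5 Prop. (5.8)] -/
theorem galoisCohomology_hom_eq_zero (hstab : UniformIsotropy K β L) (he : PermutedBasis K ρP e)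
    (ρA : DiscreteGaloisModule K W)
    (hA : ∀ (E : IntermediateField K (AlgebraicClosure K)) [FiniteDimensional K E] [Normal K E], L ≤ E →
      IsZero (groupCohomology (Rep.res ((absGaloisFixingSubgroup L).map
        (QuotientGroup.mk' (absGaloisFixingSubgroup E))).subtype (absGaloisLayerRep K E ρA)) 1))
    (ζ : galoisCohomology (homGaloisModule ρP ρA) 1) : ζ = 0 := by
  obtain ⟨E, hEfd, hEgal, y, rfl⟩ := exists_infOneLayer_eq K (homGaloisModule ρP ρA) ζ
  haveI := hEfd
  haveI := hEgal
  rw [← infOneLayer_layerInf K E (E ⊔ L) (homGaloisModule ρP ρA) le_sup_left y]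
  haveI := ModuleCat.subsingleton_of_isZero
    (isZero_layer_hom ρA hstab he (le_sup_right : L ≤ E ⊔ L) 1 (hA (E ⊔ L) le_sup_right))
  rw [Subsingleton.elim (layerInf K E (E ⊔ L) (homGaloisModule ρP ρA) le_sup_left 1 y) 0, map_zero]

end Vanishing

/-! ## §3 Coefficients `K̄ˣ`: Hilbert 90 at the layers -/

section Units

variable [CharZero K] (E : IntermediateField K (AlgebraicClosure K)) [FiniteDimensional K E] [IsGalois K E]

/-- **`(K̄ˣ)^{Γ_E} ≅ Eˣ` as representations**, along `Γ_K/Γ_E ≅ Gal(E/K)` (`unitsLayerEquiv` +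
`unitsLayerEquiv_equivariant` of `GaloisCohomologyUnitsLayerInflation`). [cite: SerreLocalFields1979, X §4 Prop. 6] -/
def unitsLayerRepIso :
    absGaloisLayerRep K E (units K) ≅
      Rep.res ((absGaloisQuotientEquiv K E : _ ≃* (E ≃ₐ[K] E)) :
        absoluteGaloisGroup K ⧸ absGaloisFixingSubgroup E →* (E ≃ₐ[K] E)) (Rep.ofAlgebraAutOnUnits K E) :=
  Rep.mkIso (Representation.Equiv.mk (unitsLayerEquiv K E) fun g => unitsLayerEquiv_equivariant K E g)

/-- **`H¹(S, (K̄ˣ)^{Γ_E}) = 0` for every subgroup `S ≤ Γ_K/Γ_E`** (Hilbert 90 for `E/E^{S}`: the engine's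
`InflationRestriction.isZero_H1_res_units`, transported along `unitsLayerRepIso` and `Γ_K/Γ_E ≅ Gal(E/K)`).
[cite: SerreLocalFields1979, X §1 Prop. 2] -/
theorem isZero_H1_res_layer_units (S : Subgroup (absoluteGaloisGroup K ⧸ absGaloisFixingSubgroup E)) :
    IsZero (groupCohomology (Rep.res S.subtype (absGaloisLayerRep K E (units K))) 1) := by
  have h3 := InflationRestriction.isZero_H1_res_units K E
    (S.map ((absGaloisQuotientEquiv K E : _ ≃* (E ≃ₐ[K] E)) : _ →* (E ≃ₐ[K] E)))
  have h2 : IsZero (groupCohomology (Rep.res S.subtype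
      (Rep.res ((absGaloisQuotientEquiv K E : _ ≃* (E ≃ₐ[K] E)) : _ →* (E ≃ₐ[K] E))
        (Rep.ofAlgebraAutOnUnits K E))) 1) :=
    h3.of_iso (groupCohomology.mapIso ((absGaloisQuotientEquiv K E).subgroupMap S) (LinearEquiv.refl ℤ _)
      (fun _ => LinearMap.ext fun _ => rfl) 1)
  exact h2.of_iso ((groupCohomology.functor ℤ S 1).mapIso
    ((Rep.resFunctor S.subtype).mapIso (unitsLayerRepIso K E)))

variable {K E}
variable {β : Type} [MulAction (absoluteGaloisGroup K) β]
  {L : IntermediateField K (AlgebraicClosure K)} [FiniteDimensional K L] [Normal K L]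
  {VP : Type} [AddCommGroup VP] [TopologicalSpace VP] [DiscreteTopology VP] [Module.Finite ℤ VP]
  {ρP : DiscreteGaloisModule K VP} {e : Module.Basis β ℤ VP}

/-- **`H¹(K, Hom(P, K̄ˣ)) = 0`** for a permutation module `P = ℤ[β]` with uniform open isotropy `Γ_L`
(characteristic `0`). [cite: MilneADT2006, I Lemma 4.13 (proof)][cite: SerreLocalFields1979, X §1 Prop. 2] -/
theorem galoisCohomology_hom_units_eq_zero (hstab : UniformIsotropy K β L) (he : PermutedBasis K ρP e)
    (ζ : galoisCohomology (homGaloisModule ρP (units K)) 1) : ζ = 0 :=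
  galoisCohomology_hom_eq_zero hstab he (units K) (fun E _ _ _ => by
    haveI : IsGalois K E := isGalois_iff.mpr ⟨inferInstance, inferInstance⟩
    exact isZero_H1_res_layer_units K E _) ζ

end Units

end HomPermutation

end Literature.NumberTheory.GaloisRepresentations

end
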